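import Summits.MatrixMultiplication.MatrixMultiplication.Theorems.SoloInformedValTwoBlockU2NOverlap

/-!
# The three-block quadratic budget (real algebra behind `SoloInformedValThreeBlockU2N`)

Solo-informed MatrixMultiplication, gen 83 (dossier `paper/val-superlinear.md` §15.8 (n)(xviii); CLAIMS c604–c605).
Pure real/natural-number algebra; the combinatorics (three complete TPP blocks, the transitive sink inequalities)
is in `SoloInformedValThreeBlockU2N`, which applies `cube_le_of_overlaps₃` below.

NOTATION.  Three blocks with row counts `x_t`, `w_t = |Y_t||Z_t|`, volumes `v_t = x_t w_t`, `n = |G|`, pairwise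
row overlaps `O_tu` and triple overlap `c`; `I' = x₁ + x₂ + x₃ + c - O₁₂ - O₁₃ - O₂₃ = |X₁ ∪ X₂ ∪ X₃|`.

* `cube_add₃_le_mul_mul` — three-term Hölder `(v₁ + v₂ + v₃)³ ≤ (Σ a_t)(Σ b_t)(Σ c_t)` whenever
  `a_t b_t c_t = v_t³` (eight AM–GM steps `three_mul_le_add_of_mul_eq_pow_three`).
* `sq_volume_le₃` — THE QUADRATIC BUDGET `x₁v₁² + x₂v₂² + x₃v₃² ≤ n² I'` from the six TRANSITIVE SINK
  INEQUALITIES `v_t + O_ut w_u + c w_s ≤ n` (`(s, u, t)` an ordering of the blocks), `0 ≤ c ≤ O_tu` and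
  `O_tu + O_ts ≤ x_t + c`.  The proof is the polynomial identity `n²I' - Σ x_t v_t² = F₁ + F₂ + F₃ + F₄ + F₅`,
  `F₁ = Σ_t x_t v_t (B_t - v_t)` (`B_t = n - ½((O_ut + c) w_u + (O_st + c) w_s)`, the average of the two sink-`t`
  bounds), `F₂ = ½ Σ_{t<u} (O_tu + c) w_t w_u (x_t - x_u)²`, `F₃ = n Σ_t (x_t + c - O_tu - O_ts)(n - v_t)`,
  `F₄ = Σ_{t<u} (O_tu - c)(n - v_t)(n - v_u)`, `F₅ = c((n - Σ_t v_t)² + Σ_t v_t (n - v_t))`, each visibly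
  non-negative (`linarith` closes the bookkeeping).  For two blocks (`x₃ = c = O₁₃ = O₂₃ = 0`) this is a
  three-line proof of `sq_volume_le` of `SoloInformedValTwoBlockU2N`.
* `cube_le_of_overlaps₃` — the numeric criterion in `ℕ`: sink inequalities + overlap bookkeeping imply
  `(x₁y₁z₁ + x₂y₂z₂ + x₃y₃z₃)³ ≤ n² · I' · (y₁ + y₂ + y₃) · (z₁ + z₂ + z₃)` (quadratic budget, then Hölder with
  `a_t = x_t v_t²`, `b_t = y_t`, `c_t = z_t`).

WHY QUADRATIC.  The LINEAR budget `Σ_t x_t v_t ≤ n I'` (true and used for two blocks) does not follow from the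
tournament inequalities for three blocks: the linear relaxation has value `4/3` (triangle row design
`X₁ = A ⊔ B`, `X₂ = A ⊔ C`, `X₃ = B ⊔ C`), whereas the quadratic relaxation has value exactly `1`
(`work/g83/kblock/relax_phi_qb.py`, and the identity above).  No `sorry`.
-/

namespace Summit.MatrixMultiplication.MatrixMultiplication.Theorems.SoloVal

open Finset

section RealLemmas

/-- Three-term Hölder inequality with three factors: if `a_t b_t c_t = v_t³` (`t = 1, 2, 3`; everything
non-negative) then `(v₁ + v₂ + v₃)³ ≤ (a₁ + a₂ + a₃)(b₁ + b₂ + b₃)(c₁ + c₂ + c₃)` (eight AM–GM steps). -/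
theorem cube_add₃_le_mul_mul {a₁ a₂ a₃ b₁ b₂ b₃ c₁ c₂ c₃ v₁ v₂ v₃ : ℝ} (ha₁ : 0 ≤ a₁) (ha₂ : 0 ≤ a₂)
    (ha₃ : 0 ≤ a₃) (hb₁ : 0 ≤ b₁) (hb₂ : 0 ≤ b₂) (hb₃ : 0 ≤ b₃) (hc₁ : 0 ≤ c₁) (hc₂ : 0 ≤ c₂)
    (hc₃ : 0 ≤ c₃) (hv₁ : 0 ≤ v₁) (hv₂ : 0 ≤ v₂) (hv₃ : 0 ≤ v₃) (h₁ : a₁ * b₁ * c₁ = v₁ ^ 3)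
    (h₂ : a₂ * b₂ * c₂ = v₂ ^ 3) (h₃ : a₃ * b₃ * c₃ = v₃ ^ 3) :
    (v₁ + v₂ + v₃) ^ 3 ≤ (a₁ + a₂ + a₃) * (b₁ + b₂ + b₃) * (c₁ + c₂ + c₃) := by
  have e₁₂ : 3 * (v₁ ^ 2 * v₂) ≤ a₁ * b₁ * c₂ + a₁ * b₂ * c₁ + a₂ * b₁ * c₁ :=
    three_mul_le_add_of_mul_eq_pow_three (by positivity) (by positivity) (by positivity) (by positivity)
      (by calc a₁ * b₁ * c₂ * (a₁ * b₂ * c₁) * (a₂ * b₁ * c₁) = (a₁ * b₁ * c₁) ^ 2 * (a₂ * b₂ * c₂) := by ring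
          _ = (v₁ ^ 2 * v₂) ^ 3 := by rw [h₁, h₂]; ring)
  have e₁₃ : 3 * (v₁ ^ 2 * v₃) ≤ a₁ * b₁ * c₃ + a₁ * b₃ * c₁ + a₃ * b₁ * c₁ :=
    three_mul_le_add_of_mul_eq_pow_three (by positivity) (by positivity) (by positivity) (by positivity)
      (by calc a₁ * b₁ * c₃ * (a₁ * b₃ * c₁) * (a₃ * b₁ * c₁) = (a₁ * b₁ * c₁) ^ 2 * (a₃ * b₃ * c₃) := by ring
          _ = (v₁ ^ 2 * v₃) ^ 3 := by rw [h₁, h₃]; ring)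
  have e₂₁ : 3 * (v₂ ^ 2 * v₁) ≤ a₂ * b₂ * c₁ + a₂ * b₁ * c₂ + a₁ * b₂ * c₂ :=
    three_mul_le_add_of_mul_eq_pow_three (by positivity) (by positivity) (by positivity) (by positivity)
      (by calc a₂ * b₂ * c₁ * (a₂ * b₁ * c₂) * (a₁ * b₂ * c₂) = (a₂ * b₂ * c₂) ^ 2 * (a₁ * b₁ * c₁) := by ring
          _ = (v₂ ^ 2 * v₁) ^ 3 := by rw [h₁, h₂]; ring)
  have e₂₃ : 3 * (v₂ ^ 2 * v₃) ≤ a₂ * b₂ * c₃ + a₂ * b₃ * c₂ + a₃ * b₂ * c₂ :=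
    three_mul_le_add_of_mul_eq_pow_three (by positivity) (by positivity) (by positivity) (by positivity)
      (by calc a₂ * b₂ * c₃ * (a₂ * b₃ * c₂) * (a₃ * b₂ * c₂) = (a₂ * b₂ * c₂) ^ 2 * (a₃ * b₃ * c₃) := by ring
          _ = (v₂ ^ 2 * v₃) ^ 3 := by rw [h₂, h₃]; ring)
  have e₃₁ : 3 * (v₃ ^ 2 * v₁) ≤ a₃ * b₃ * c₁ + a₃ * b₁ * c₃ + a₁ * b₃ * c₃ :=
    three_mul_le_add_of_mul_eq_pow_three (by positivity) (by positivity) (by positivity) (by positivity)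
      (by calc a₃ * b₃ * c₁ * (a₃ * b₁ * c₃) * (a₁ * b₃ * c₃) = (a₃ * b₃ * c₃) ^ 2 * (a₁ * b₁ * c₁) := by ring
          _ = (v₃ ^ 2 * v₁) ^ 3 := by rw [h₁, h₃]; ring)
  have e₃₂ : 3 * (v₃ ^ 2 * v₂) ≤ a₃ * b₃ * c₂ + a₃ * b₂ * c₃ + a₂ * b₃ * c₃ :=
    three_mul_le_add_of_mul_eq_pow_three (by positivity) (by positivity) (by positivity) (by positivity)
      (by calc a₃ * b₃ * c₂ * (a₃ * b₂ * c₃) * (a₂ * b₃ * c₃) = (a₃ * b₃ * c₃) ^ 2 * (a₂ * b₂ * c₂) := by ring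
          _ = (v₃ ^ 2 * v₂) ^ 3 := by rw [h₂, h₃]; ring)
  have f₁ : 3 * (v₁ * v₂ * v₃) ≤ a₁ * b₂ * c₃ + a₂ * b₃ * c₁ + a₃ * b₁ * c₂ :=
    three_mul_le_add_of_mul_eq_pow_three (by positivity) (by positivity) (by positivity) (by positivity)
      (by calc a₁ * b₂ * c₃ * (a₂ * b₃ * c₁) * (a₃ * b₁ * c₂)
            = (a₁ * b₁ * c₁) * (a₂ * b₂ * c₂) * (a₃ * b₃ * c₃) := by ring
          _ = (v₁ * v₂ * v₃) ^ 3 := by rw [h₁, h₂, h₃]; ring)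
  have f₂ : 3 * (v₁ * v₂ * v₃) ≤ a₁ * b₃ * c₂ + a₂ * b₁ * c₃ + a₃ * b₂ * c₁ :=
    three_mul_le_add_of_mul_eq_pow_three (by positivity) (by positivity) (by positivity) (by positivity)
      (by calc a₁ * b₃ * c₂ * (a₂ * b₁ * c₃) * (a₃ * b₂ * c₁)
            = (a₁ * b₁ * c₁) * (a₂ * b₂ * c₂) * (a₃ * b₃ * c₃) := by ring
          _ = (v₁ * v₂ * v₃) ^ 3 := by rw [h₁, h₂, h₃]; ring)
  linarith [e₁₂, e₁₃, e₂₁, e₂₃, e₃₁, e₃₂, f₁, f₂, h₁, h₂, h₃]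

/-- THE THREE-BLOCK QUADRATIC BUDGET.  With `v_t = x_t w_t`: if `0 ≤ c ≤ O_tu`, `O_tu + O_ts ≤ x_t + c`,
`w_t ≥ 0` and the six transitive sink inequalities `v_t + O_ut w_u + c w_s ≤ n` hold, then
`x₁v₁² + x₂v₂² + x₃v₃² ≤ n²(x₁ + x₂ + x₃ + c - O₁₂ - O₁₃ - O₂₃)`.  Proof: the identity
`n²I' - Σ x_t v_t² = F₁ + F₂ + F₃ + F₄ + F₅` of the module docstring, each `F_i ≥ 0`. -/
theorem sq_volume_le₃ {n c O₁₂ O₁₃ O₂₃ x₁ x₂ x₃ w₁ w₂ w₃ : ℝ} (hc : 0 ≤ c) (hc₁₂ : c ≤ O₁₂)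
    (hc₁₃ : c ≤ O₁₃) (hc₂₃ : c ≤ O₂₃) (hx₁ : O₁₂ + O₁₃ ≤ x₁ + c) (hx₂ : O₁₂ + O₂₃ ≤ x₂ + c)
    (hx₃ : O₁₃ + O₂₃ ≤ x₃ + c) (hw₁ : 0 ≤ w₁) (hw₂ : 0 ≤ w₂) (hw₃ : 0 ≤ w₃)
    (h₁₂ : x₁ * w₁ + O₁₂ * w₂ + c * w₃ ≤ n) (h₁₃ : x₁ * w₁ + O₁₃ * w₃ + c * w₂ ≤ n)
    (h₂₁ : x₂ * w₂ + O₁₂ * w₁ + c * w₃ ≤ n) (h₂₃ : x₂ * w₂ + O₂₃ * w₃ + c * w₁ ≤ n)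
    (h₃₁ : x₃ * w₃ + O₁₃ * w₁ + c * w₂ ≤ n) (h₃₂ : x₃ * w₃ + O₂₃ * w₂ + c * w₁ ≤ n) :
    x₁ * (x₁ * w₁) ^ 2 + x₂ * (x₂ * w₂) ^ 2 + x₃ * (x₃ * w₃) ^ 2
      ≤ n ^ 2 * (x₁ + x₂ + x₃ + c - O₁₂ - O₁₃ - O₂₃) := by
  have hx₁' : 0 ≤ x₁ := by linarith
  have hx₂' : 0 ≤ x₂ := by linarith
  have hx₃' : 0 ≤ x₃ := by linarith
  have hv₁ : 0 ≤ x₁ * w₁ := mul_nonneg hx₁' hw₁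
  have hv₂ : 0 ≤ x₂ * w₂ := mul_nonneg hx₂' hw₂
  have hv₃ : 0 ≤ x₃ * w₃ := mul_nonneg hx₃' hw₃
  have hO₁₂w₁ : 0 ≤ O₁₂ * w₁ := mul_nonneg (hc.trans hc₁₂) hw₁
  have hO₁₂w₂ : 0 ≤ O₁₂ * w₂ := mul_nonneg (hc.trans hc₁₂) hw₂
  have hO₁₃w₁ : 0 ≤ O₁₃ * w₁ := mul_nonneg (hc.trans hc₁₃) hw₁
  have hcw₁ : 0 ≤ c * w₁ := mul_nonneg hc hw₁
  have hcw₂ : 0 ≤ c * w₂ := mul_nonneg hc hw₂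
  have hcw₃ : 0 ≤ c * w₃ := mul_nonneg hc hw₃
  have hn₁ : x₁ * w₁ ≤ n := by linarith
  have hn₂ : x₂ * w₂ ≤ n := by linarith
  have hn₃ : x₃ * w₃ ≤ n := by linarith
  have hn : 0 ≤ n := hv₁.trans hn₁
  -- F₁: the averaged sink bounds, multiplied by `x_t v_t ≥ 0`
  have F1₁ : 0 ≤ x₁ * (x₁ * w₁) * (n - ((O₁₂ + c) * w₂ + (O₁₃ + c) * w₃) / 2 - x₁ * w₁) :=
    mul_nonneg (mul_nonneg hx₁' hv₁) (by linarith)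
  have F1₂ : 0 ≤ x₂ * (x₂ * w₂) * (n - ((O₁₂ + c) * w₁ + (O₂₃ + c) * w₃) / 2 - x₂ * w₂) :=
    mul_nonneg (mul_nonneg hx₂' hv₂) (by linarith)
  have F1₃ : 0 ≤ x₃ * (x₃ * w₃) * (n - ((O₁₃ + c) * w₁ + (O₂₃ + c) * w₂) / 2 - x₃ * w₃) :=
    mul_nonneg (mul_nonneg hx₃' hv₃) (by linarith)
  -- F₂: AM–GM on the cross terms
  have F2₁₂ : 0 ≤ (O₁₂ + c) * w₁ * w₂ * (x₁ - x₂) ^ 2 :=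
    mul_nonneg (mul_nonneg (mul_nonneg (by linarith) hw₁) hw₂) (sq_nonneg _)
  have F2₁₃ : 0 ≤ (O₁₃ + c) * w₁ * w₃ * (x₁ - x₃) ^ 2 :=
    mul_nonneg (mul_nonneg (mul_nonneg (by linarith) hw₁) hw₃) (sq_nonneg _)
  have F2₂₃ : 0 ≤ (O₂₃ + c) * w₂ * w₃ * (x₂ - x₃) ^ 2 :=
    mul_nonneg (mul_nonneg (mul_nonneg (by linarith) hw₂) hw₃) (sq_nonneg _)
  -- F₃: `x_t ≥ O_tu + O_ts - c`, multiplied by `n (n - v_t) ≥ 0`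
  have F3₁ : 0 ≤ n * ((x₁ + c - O₁₂ - O₁₃) * (n - x₁ * w₁)) :=
    mul_nonneg hn (mul_nonneg (by linarith) (by linarith))
  have F3₂ : 0 ≤ n * ((x₂ + c - O₁₂ - O₂₃) * (n - x₂ * w₂)) :=
    mul_nonneg hn (mul_nonneg (by linarith) (by linarith))
  have F3₃ : 0 ≤ n * ((x₃ + c - O₁₃ - O₂₃) * (n - x₃ * w₃)) :=
    mul_nonneg hn (mul_nonneg (by linarith) (by linarith))
  -- F₄ and F₅: the closing positivity
  have F4₁₂ : 0 ≤ (O₁₂ - c) * ((n - x₁ * w₁) * (n - x₂ * w₂)) :=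
    mul_nonneg (by linarith) (mul_nonneg (by linarith) (by linarith))
  have F4₁₃ : 0 ≤ (O₁₃ - c) * ((n - x₁ * w₁) * (n - x₃ * w₃)) :=
    mul_nonneg (by linarith) (mul_nonneg (by linarith) (by linarith))
  have F4₂₃ : 0 ≤ (O₂₃ - c) * ((n - x₂ * w₂) * (n - x₃ * w₃)) :=
    mul_nonneg (by linarith) (mul_nonneg (by linarith) (by linarith))
  have F5 : 0 ≤ c * ((n - (x₁ * w₁ + x₂ * w₂ + x₃ * w₃)) ^ 2 + x₁ * w₁ * (n - x₁ * w₁)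
      + x₂ * w₂ * (n - x₂ * w₂) + x₃ * w₃ * (n - x₃ * w₃)) :=
    mul_nonneg hc (add_nonneg (add_nonneg (add_nonneg (sq_nonneg _) (mul_nonneg hv₁ (by linarith)))
      (mul_nonneg hv₂ (by linarith))) (mul_nonneg hv₃ (by linarith)))
  linarith [F1₁, F1₂, F1₃, F2₁₂, F2₁₃, F2₂₃, F3₁, F3₂, F3₃, F4₁₂, F4₁₃, F4₂₃, F5]

/-- THE NUMERIC CRITERION.  Natural numbers satisfying the six transitive sink inequalities, `c ≤ O_tu`,
`O_tu + O_ts ≤ x_t + c` and `i + O₁₂ + O₁₃ + O₂₃ = x₁ + x₂ + x₃ + c` satisfy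
`(x₁y₁z₁ + x₂y₂z₂ + x₃y₃z₃)³ ≤ n²·i·(y₁ + y₂ + y₃)·(z₁ + z₂ + z₃)`. -/
theorem cube_le_of_overlaps₃ {n x₁ y₁ z₁ x₂ y₂ z₂ x₃ y₃ z₃ c O₁₂ O₁₃ O₂₃ i : ℕ}
    (h₁₂ : x₁ * y₁ * z₁ + O₁₂ * y₂ * z₂ + c * y₃ * z₃ ≤ n)
    (h₁₃ : x₁ * y₁ * z₁ + O₁₃ * y₃ * z₃ + c * y₂ * z₂ ≤ n)
    (h₂₁ : x₂ * y₂ * z₂ + O₁₂ * y₁ * z₁ + c * y₃ * z₃ ≤ n)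
    (h₂₃ : x₂ * y₂ * z₂ + O₂₃ * y₃ * z₃ + c * y₁ * z₁ ≤ n)
    (h₃₁ : x₃ * y₃ * z₃ + O₁₃ * y₁ * z₁ + c * y₂ * z₂ ≤ n)
    (h₃₂ : x₃ * y₃ * z₃ + O₂₃ * y₂ * z₂ + c * y₁ * z₁ ≤ n)
    (hc₁₂ : c ≤ O₁₂) (hc₁₃ : c ≤ O₁₃) (hc₂₃ : c ≤ O₂₃) (hx₁ : O₁₂ + O₁₃ ≤ x₁ + c)
    (hx₂ : O₁₂ + O₂₃ ≤ x₂ + c) (hx₃ : O₁₃ + O₂₃ ≤ x₃ + c)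
    (hi : i + O₁₂ + O₁₃ + O₂₃ = x₁ + x₂ + x₃ + c) :
    (x₁ * y₁ * z₁ + x₂ * y₂ * z₂ + x₃ * y₃ * z₃) ^ 3
      ≤ n ^ 2 * i * (y₁ + y₂ + y₃) * (z₁ + z₂ + z₃) := by
  have h₁₂' : (x₁ : ℝ) * ((y₁ : ℝ) * z₁) + (O₁₂ : ℝ) * ((y₂ : ℝ) * z₂) + (c : ℝ) * ((y₃ : ℝ) * z₃) ≤ n := by
    have h := (Nat.cast_le (α := ℝ)).mpr h₁₂
    push_cast at h
    linarith
  have h₁₃' : (x₁ : ℝ) * ((y₁ : ℝ) * z₁) + (O₁₃ : ℝ) * ((y₃ : ℝ) * z₃) + (c : ℝ) * ((y₂ : ℝ) * z₂) ≤ n := by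
    have h := (Nat.cast_le (α := ℝ)).mpr h₁₃
    push_cast at h
    linarith
  have h₂₁' : (x₂ : ℝ) * ((y₂ : ℝ) * z₂) + (O₁₂ : ℝ) * ((y₁ : ℝ) * z₁) + (c : ℝ) * ((y₃ : ℝ) * z₃) ≤ n := by
    have h := (Nat.cast_le (α := ℝ)).mpr h₂₁
    push_cast at h
    linarith
  have h₂₃' : (x₂ : ℝ) * ((y₂ : ℝ) * z₂) + (O₂₃ : ℝ) * ((y₃ : ℝ) * z₃) + (c : ℝ) * ((y₁ : ℝ) * z₁) ≤ n := by
    have h := (Nat.cast_le (α := ℝ)).mpr h₂₃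
    push_cast at h
    linarith
  have h₃₁' : (x₃ : ℝ) * ((y₃ : ℝ) * z₃) + (O₁₃ : ℝ) * ((y₁ : ℝ) * z₁) + (c : ℝ) * ((y₂ : ℝ) * z₂) ≤ n := by
    have h := (Nat.cast_le (α := ℝ)).mpr h₃₁
    push_cast at h
    linarith
  have h₃₂' : (x₃ : ℝ) * ((y₃ : ℝ) * z₃) + (O₂₃ : ℝ) * ((y₂ : ℝ) * z₂) + (c : ℝ) * ((y₁ : ℝ) * z₁) ≤ n := by
    have h := (Nat.cast_le (α := ℝ)).mpr h₃₂
    push_cast at h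
    linarith
  have hc₁₂' : (c : ℝ) ≤ O₁₂ := by exact_mod_cast hc₁₂
  have hc₁₃' : (c : ℝ) ≤ O₁₃ := by exact_mod_cast hc₁₃
  have hc₂₃' : (c : ℝ) ≤ O₂₃ := by exact_mod_cast hc₂₃
  have hx₁' : (O₁₂ : ℝ) + O₁₃ ≤ x₁ + c := by exact_mod_cast hx₁
  have hx₂' : (O₁₂ : ℝ) + O₂₃ ≤ x₂ + c := by exact_mod_cast hx₂
  have hx₃' : (O₁₃ : ℝ) + O₂₃ ≤ x₃ + c := by exact_mod_cast hx₃
  have hi' : (i : ℝ) = x₁ + x₂ + x₃ + c - O₁₂ - O₁₃ - O₂₃ := by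
    have h := congrArg (Nat.cast (R := ℝ)) hi
    push_cast at h
    linarith
  have L := sq_volume_le₃ (Nat.cast_nonneg c) hc₁₂' hc₁₃' hc₂₃' hx₁' hx₂' hx₃' (by positivity)
    (by positivity) (by positivity) h₁₂' h₁₃' h₂₁' h₂₃' h₃₁' h₃₂'
  have H := cube_add₃_le_mul_mul (v₁ := (x₁ : ℝ) * ((y₁ : ℝ) * z₁)) (v₂ := (x₂ : ℝ) * ((y₂ : ℝ) * z₂))
    (v₃ := (x₃ : ℝ) * ((y₃ : ℝ) * z₃)) (a₁ := (x₁ : ℝ) * ((x₁ : ℝ) * ((y₁ : ℝ) * z₁)) ^ 2)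
    (a₂ := (x₂ : ℝ) * ((x₂ : ℝ) * ((y₂ : ℝ) * z₂)) ^ 2) (a₃ := (x₃ : ℝ) * ((x₃ : ℝ) * ((y₃ : ℝ) * z₃)) ^ 2)
    (b₁ := (y₁ : ℝ)) (b₂ := (y₂ : ℝ)) (b₃ := (y₃ : ℝ)) (c₁ := (z₁ : ℝ)) (c₂ := (z₂ : ℝ)) (c₃ := (z₃ : ℝ))
    (by positivity) (by positivity) (by positivity) (by positivity) (by positivity) (by positivity)
    (by positivity) (by positivity) (by positivity) (by positivity) (by positivity) (by positivity)
    (by ring) (by ring) (by ring)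
  have key : ((x₁ : ℝ) * y₁ * z₁ + x₂ * y₂ * z₂ + x₃ * y₃ * z₃) ^ 3
      ≤ (n : ℝ) ^ 2 * i * (y₁ + y₂ + y₃) * (z₁ + z₂ + z₃) :=
    calc ((x₁ : ℝ) * y₁ * z₁ + x₂ * y₂ * z₂ + x₃ * y₃ * z₃) ^ 3
        = ((x₁ : ℝ) * ((y₁ : ℝ) * z₁) + (x₂ : ℝ) * ((y₂ : ℝ) * z₂) + (x₃ : ℝ) * ((y₃ : ℝ) * z₃)) ^ 3 := by
          ring
      _ ≤ ((x₁ : ℝ) * ((x₁ : ℝ) * ((y₁ : ℝ) * z₁)) ^ 2 + (x₂ : ℝ) * ((x₂ : ℝ) * ((y₂ : ℝ) * z₂)) ^ 2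
            + (x₃ : ℝ) * ((x₃ : ℝ) * ((y₃ : ℝ) * z₃)) ^ 2) * ((y₁ : ℝ) + y₂ + y₃) * ((z₁ : ℝ) + z₂ + z₃) := H
      _ ≤ (n : ℝ) ^ 2 * ((x₁ : ℝ) + x₂ + x₃ + c - O₁₂ - O₁₃ - O₂₃) * ((y₁ : ℝ) + y₂ + y₃)
            * ((z₁ : ℝ) + z₂ + z₃) :=
          mul_le_mul_of_nonneg_right (mul_le_mul_of_nonneg_right L (by positivity)) (by positivity)
      _ = (n : ℝ) ^ 2 * i * (y₁ + y₂ + y₃) * (z₁ + z₂ + z₃) := by rw [hi']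
  exact_mod_cast key

end RealLemmas

end Summit.MatrixMultiplication.MatrixMultiplication.Theorems.SoloVal
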